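import Literature.Analysis.FluidPDE.CarlemanDensity
import HarnessLib

/-!
# Carleman inequalities in the class `C¹ ∩ {∂ₓu ∈ C¹}` (density, verbatim)

Analysis/FluidPDE support file (theorems only; no definitions, no named facts) in the
backward-uniqueness / unique-continuation track used by the discharge of ESS Thm. 1.4
(`Literature.Analysis.FluidPDE.ess_local_holder`). The density file `CarlemanDensity.lean`
extends the two Carleman inequalities of Escauriaza–Seregin–Šverák (Seregin 2014, App. A,
Props. 1.2–1.3) from `C_c^∞` to `C_c²` data. Its proof never differentiates twice in time: it
uses only `u ∈ C¹`, `∂ₑu ∈ C¹` for the spatial directions `e` (so that `∂ₜu`, `∂ₑ∂ₑu` are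
continuous and commute with mollification). This file records the same statements for that
larger class,

  `u ∈ C¹(ℝ × E)`, `∂ₑu = Du(·)(0, e) ∈ C¹(ℝ × E)` for every `e ∈ E`, compact support,

which is the regularity of the vorticity `ω = curl u` of a Navier–Stokes solution that is smooth
in space with jointly continuous spatial derivatives but only `C¹` in time (the far field of the
blow-up limit in ESS §3, where `∂ₜ²ω` involves the time derivative of the non-local pressure and
need not exist; likewise Lemarié-Rieusset 2016, proof of Thm. 15.4, Step 3). The printed theorems
(ESS 2003, Thms. 4.1 and 5.1; Seregin 2014, Thms. A.2.4 and A.3.5) are stated for `W^{2,1}_2`,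
which contains this class.

* `dt_add_lap_mollify_c12` — `(∂ₜ + Δ)(φ ⋆ u) = φ ⋆ (∂ₜu + Δu)` in the class;
* `weightedIneq_of_c12` — the density theorem `weightedIneq_of_smooth` in the class (same proof);
* `carleman_inequality_first_of_c12`, `carleman_inequality_second_of_c12` — the two Carleman
  inequalities in the class.

## References

* G. Seregin, *Lecture notes on regularity theory for the Navier–Stokes equations*, World
  Scientific 2014, App. A.1, Props. 1.2–1.3; A.2–A.3 (application to `W^{2,1}_2` cut-offs).
* L. Escauriaza, G. Seregin, V. Šverák, Russ. Math. Surveys 58:2 (2003) 211–250, §§4–6.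
-/

noncomputable section

open MeasureTheory Set Function Filter Topology ContinuousLinearMap
open scoped InnerProductSpace RealInnerProductSpace Convolution

namespace Literature.Analysis.FluidPDE

namespace Carleman

section Mollify

variable {E : Type*} [NormedAddCommGroup E] [InnerProductSpace ℝ E] [FiniteDimensional ℝ E]
  [MeasurableSpace E] [BorelSpace E]
variable {F : Type*} [NormedAddCommGroup F] [InnerProductSpace ℝ F]

variable (φ : ContDiffBump (0 : ℝ × E))

/-- **`(∂ₜ + Δ)(φ ⋆ u) = φ ⋆ (∂ₜu + Δu)`** for compactly supported `u ∈ C¹` with `∂ₑu ∈ C¹` for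
every direction `e` (the class `C¹ ∩ {∂ₓu ∈ C¹}`, containing `C_c²`). [folklore] -/
theorem dt_add_lap_mollify_c12 {U : ℝ × E → F} (hU1 : ContDiff ℝ 1 U)
    (hdx1 : ∀ e : E, ContDiff ℝ 1 (dx e U)) (hUc : HasCompactSupport U) (z : ℝ × E) :
    dt (mollify φ U) z + lap (mollify φ U) z = mollify φ (fun y => dt U y + lap U y) z := by
  have hdxc : ∀ e : E, HasCompactSupport (dx e U) := fun e => hasCompactSupport_dx hUc e
  have cdt : Continuous (dt U) := (hU1.continuous_fderiv one_ne_zero).clm_apply continuous_const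
  have cdxdx : ∀ e : E, Continuous (dx e (dx e U)) := fun e =>
    (contDiff_fderiv_apply_const_of_succ (n := 0) (hdx1 e) (0, e)).continuous
  have clap : Continuous (lap U) := by
    unfold lap
    exact continuous_finsetSum _ fun i _ => cdxdx _
  have hlap : lap (mollify φ U) z = mollify φ (lap U) z := by
    have step : ∀ i, dx (stdOrthonormalBasis ℝ E i) (dx (stdOrthonormalBasis ℝ E i) (mollify φ U)) z =
        mollify φ (dx (stdOrthonormalBasis ℝ E i) (dx (stdOrthonormalBasis ℝ E i) U)) z := by
      intro i
      rw [dx_mollify φ hU1 hUc, dx_mollify φ (hdx1 _) (hdxc _)]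
    show ∑ i, dx (stdOrthonormalBasis ℝ E i) (dx (stdOrthonormalBasis ℝ E i) (mollify φ U)) z = _
    rw [Finset.sum_congr rfl fun i _ => step i,
      ← mollify_finset_sum φ Finset.univ fun i => cdxdx (stdOrthonormalBasis ℝ E i)]
    rfl
  rw [dt_mollify φ hU1 hUc, hlap, ← mollify_add φ cdt clap]


/-- **Weighted Carleman-type inequalities pass from `C_c^∞` to compactly supported data in the
class `C¹ ∩ {∂ₓu ∈ C¹}`.** Let `O ⊆ ℝ × E`
be open, `w₁, w₂, w₃` continuous on `O`, and suppose that
`∫ (w₁|v|² + w₂|∇v|²) ≤ C ∫ w₃|∂ₜv + Δv|²` for every smooth `v` with compact support in `O`.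
Then the same inequality holds for every `u ∈ C¹` with `∂ₑu ∈ C¹` for all `e ∈ E` and compact
support in `O` — the proof of `weightedIneq_of_smooth` verbatim, which never used `∂ₜ²u`
(mollify, apply, and pass to the limit by dominated convergence: the mollifications and their
first/second derivatives are supported in a fixed compact subset of `O`, bounded by the sups of
the corresponding derivatives of `u`, and converge pointwise). [folklore] -/
theorem weightedIneq_of_c12 [CompleteSpace F] {O : Set (ℝ × E)} (hO : IsOpen O)
    {w₁ w₂ w₃ : ℝ × E → ℝ} (hw₁ : ContinuousOn w₁ O) (hw₂ : ContinuousOn w₂ O)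
    (hw₃ : ContinuousOn w₃ O) {C : ℝ}
    (H : ∀ V : ℝ × E → F, ContDiff ℝ (⊤ : ℕ∞) V → HasCompactSupport V → tsupport V ⊆ O →
      ∫ z, (w₁ z * ‖V z‖ ^ 2 + w₂ z * gradSq V z) ≤ C * ∫ z, w₃ z * ‖dt V z + lap V z‖ ^ 2)
    {U : ℝ × E → F} (hU1 : ContDiff ℝ 1 U) (hdx1 : ∀ e : E, ContDiff ℝ 1 (dx e U))
    (hUc : HasCompactSupport U) (hUO : tsupport U ⊆ O) :
    ∫ z, (w₁ z * ‖U z‖ ^ 2 + w₂ z * gradSq U z) ≤ C * ∫ z, w₃ z * ‖dt U z + lap U z‖ ^ 2 := by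
  haveI : (volume : Measure (ℝ × E)).IsAddHaarMeasure := isAddHaarMeasure_volume_prod
  set b := stdOrthonormalBasis ℝ E with hb
  -- ## room around the support, the bumps, the mollifications
  obtain ⟨r, hr, hrO⟩ := hUc.isCompact.exists_cthickening_subset_open hO hUO
  set K' : Set (ℝ × E) := Metric.cthickening r (tsupport U) with hK'
  have hK'c : IsCompact K' := hUc.isCompact.cthickening
  have hK'O : K' ⊆ O := hrO
  have hK'm : MeasurableSet K' := Metric.isClosed_cthickening.measurableSet
  have hKK' : tsupport U ⊆ K' := Metric.self_subset_cthickening _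
  have hrk : ∀ k : ℕ, (0 : ℝ) < r / (2 * ((k : ℝ) + 2)) ∧ r / (2 * ((k : ℝ) + 2)) < r / ((k : ℝ) + 2) := by
    intro k
    have hk : (0 : ℝ) < (k : ℝ) + 2 := by positivity
    refine ⟨by positivity, ?_⟩
    rw [div_lt_div_iff₀ (by positivity) hk]
    nlinarith
  let φ : ℕ → ContDiffBump (0 : ℝ × E) := fun k =>
    ⟨r / (2 * ((k : ℝ) + 2)), r / ((k : ℝ) + 2), (hrk k).1, (hrk k).2⟩
  have hφr : ∀ k, (φ k).rOut = r / ((k : ℝ) + 2) := fun k => rfl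
  have hφle : ∀ k, (φ k).rOut ≤ r := fun k => by
    rw [hφr, div_le_iff₀ (by positivity)]
    nlinarith [hr.le, (Nat.cast_nonneg k : (0 : ℝ) ≤ k)]
  have hφ0 : Tendsto (fun k => (φ k).rOut) atTop (𝓝 0) := by
    simp only [hφr]; exact tendsto_div_nat_add_two r
  set Uk : ℕ → ℝ × E → F := fun k => mollify (φ k) U with hUk
  have cU : Continuous U := hU1.continuous
  have cdx : ∀ e : E, Continuous (dx e U) := fun e => (hdx1 e).continuous
  have cdt : Continuous (dt U) := (hU1.continuous_fderiv one_ne_zero).clm_apply continuous_const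
  have cdxdx : ∀ e : E, Continuous (dx e (dx e U)) := fun e =>
    (contDiff_fderiv_apply_const_of_succ (n := 0) (hdx1 e) (0, e)).continuous
  have clap : Continuous (lap U) := by
    unfold lap; exact continuous_finsetSum _ fun i _ => cdxdx _
  have cPL : Continuous fun y => dt U y + lap U y := cdt.add clap
  have hks : ∀ k, ContDiff ℝ (⊤ : ℕ∞) (Uk k) := fun k => contDiff_mollify _ cU
  have hkc : ∀ k, HasCompactSupport (Uk k) := fun k => hasCompactSupport_mollify _ hUc
  have hkK : ∀ k, tsupport (Uk k) ⊆ K' := fun k =>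
    (tsupport_mollify_subset _ U).trans (Metric.cthickening_mono (hφle k) _)
  have hkO : ∀ k, tsupport (Uk k) ⊆ O := fun k => (hkK k).trans hK'O
  have Hk : ∀ k, ∫ z, (w₁ z * ‖Uk k z‖ ^ 2 + w₂ z * gradSq (Uk k) z) ≤
      C * ∫ z, w₃ z * ‖dt (Uk k) z + lap (Uk k) z‖ ^ 2 := fun k => H _ (hks k) (hkc k) (hkO k)
  -- ## derivatives of the mollifications
  have hkdx : ∀ k i, dx (b i) (Uk k) = mollify (φ k) (dx (b i) U) := fun k i => dx_mollify _ hU1 hUc _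
  have hkPL : ∀ k z, dt (Uk k) z + lap (Uk k) z = mollify (φ k) (fun y => dt U y + lap U y) z :=
    fun k z => dt_add_lap_mollify_c12 _ hU1 hdx1 hUc z
  -- ## pointwise convergence
  have limU : ∀ z, Tendsto (fun k => Uk k z) atTop (𝓝 (U z)) := fun z =>
    ContDiffBump.convolution_tendsto_right_of_continuous hφ0 cU z
  have limdx : ∀ i z, Tendsto (fun k => dx (b i) (Uk k) z) atTop (𝓝 (dx (b i) U z)) := by
    intro i z
    simp only [hkdx]
    exact ContDiffBump.convolution_tendsto_right_of_continuous hφ0 (cdx _) z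
  have limPL : ∀ z, Tendsto (fun k => dt (Uk k) z + lap (Uk k) z) atTop (𝓝 (dt U z + lap U z)) := by
    intro z
    simp only [hkPL]
    exact ContDiffBump.convolution_tendsto_right_of_continuous hφ0 cPL z
  -- ## uniform bounds
  obtain ⟨B₀, hB₀⟩ := cU.bounded_above_of_compact_support hUc
  have hBi' : ∀ i, ∃ Bi, ∀ y, ‖dx (b i) U y‖ ≤ Bi := fun i =>
    (cdx _).bounded_above_of_compact_support (hasCompactSupport_dx hUc _)
  choose Bi hBi using hBi'
  have hPLc : HasCompactSupport fun y => dt U y + lap U y := by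
    refine hUc.mono' fun z hz => ?_
    by_contra h
    apply hz
    show dt U z + lap U z = 0
    rw [dt_apply, fderiv_of_notMem_tsupport (𝕜 := ℝ) h,
      image_eq_zero_of_notMem_tsupport fun h' => h (tsupport_lap_subset _ h')]
    simp
  obtain ⟨B₃, hB₃⟩ := cPL.bounded_above_of_compact_support hPLc
  have bU : ∀ k z, ‖Uk k z‖ ≤ B₀ := fun k z => norm_mollify_le _ hB₀ z
  have bdx : ∀ k i z, ‖dx (b i) (Uk k) z‖ ≤ Bi i := fun k i z => by
    rw [hkdx]; exact norm_mollify_le _ (hBi i) z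
  have bPL : ∀ k z, ‖dt (Uk k) z + lap (Uk k) z‖ ≤ B₃ := fun k z => by
    rw [hkPL]; exact norm_mollify_le _ hB₃ z
  obtain ⟨M₁, hM₁⟩ := hK'c.exists_bound_of_continuousOn (hw₁.mono hK'O)
  obtain ⟨M₂, hM₂⟩ := hK'c.exists_bound_of_continuousOn (hw₂.mono hK'O)
  obtain ⟨M₃, hM₃⟩ := hK'c.exists_bound_of_continuousOn (hw₃.mono hK'O)
  -- ## vanishing off `K'`
  have offU : ∀ z ∉ K', U z = 0 := fun z hz => image_eq_zero_of_notMem_tsupport fun h => hz (hKK' h)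
  have offUk : ∀ k, ∀ z ∉ K', Uk k z = 0 := fun k z hz =>
    image_eq_zero_of_notMem_tsupport fun h => hz (hkK k h)
  have offG : ∀ z ∉ K', gradSq U z = 0 := fun z hz => by
    simp [gradSq, dx, fderiv_of_notMem_tsupport (𝕜 := ℝ) (fun h => hz (hKK' h))]
  have offGk : ∀ k, ∀ z ∉ K', gradSq (Uk k) z = 0 := fun k z hz => by
    simp [gradSq, dx, fderiv_of_notMem_tsupport (𝕜 := ℝ) (fun h => hz (hkK k h))]
  have offPL : ∀ z ∉ K', dt U z + lap U z = 0 := fun z hz => by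
    have h1 : z ∉ tsupport U := fun h => hz (hKK' h)
    rw [dt_apply, fderiv_of_notMem_tsupport (𝕜 := ℝ) h1,
      image_eq_zero_of_notMem_tsupport fun h => h1 (tsupport_lap_subset _ h)]
    simp
  have offPLk : ∀ k, ∀ z ∉ K', dt (Uk k) z + lap (Uk k) z = 0 := fun k z hz => by
    have h1 : z ∉ tsupport (Uk k) := fun h => hz (hkK k h)
    rw [dt_apply, fderiv_of_notMem_tsupport (𝕜 := ℝ) h1,
      image_eq_zero_of_notMem_tsupport fun h => h1 (tsupport_lap_subset _ h)]
    simp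
  -- ## continuity of the integrands (gluing across `∂O`)
  have cG : ∀ (w : ℝ × E → ℝ), ContinuousOn w O → ∀ V : ℝ × E → F, ContDiff ℝ 1 V →
      tsupport V ⊆ O → Continuous fun z => w z * gradSq V z := by
    intro w hw V hV hVO
    have e : (fun z => w z * gradSq V z) = fun z => ∑ i, w z * ‖dx (b i) V z‖ ^ 2 := by
      funext z; rw [gradSq, Finset.mul_sum]
    rw [e]
    exact continuous_finsetSum _ fun i _ =>
      continuous_mul_norm_sq_of_tsupport_subset hO hw
        ((hV.continuous_fderiv one_ne_zero).clm_apply continuous_const)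
        ((tsupport_dx_subset _ V).trans hVO)
  have hPLs : ∀ V : ℝ × E → F, tsupport (fun z => dt V z + lap V z) ⊆ tsupport V := by
    intro V
    refine closure_minimal (fun z hz => ?_) (isClosed_tsupport V)
    by_contra h
    apply hz
    show dt V z + lap V z = 0
    rw [dt_apply, fderiv_of_notMem_tsupport (𝕜 := ℝ) h,
      image_eq_zero_of_notMem_tsupport fun h' => h (tsupport_lap_subset _ h')]
    simp
  set F₁ : ℕ → ℝ × E → ℝ := fun k z => w₁ z * ‖Uk k z‖ ^ 2 + w₂ z * gradSq (Uk k) z with hF₁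
  set f₁ : ℝ × E → ℝ := fun z => w₁ z * ‖U z‖ ^ 2 + w₂ z * gradSq U z with hf₁
  set F₂ : ℕ → ℝ × E → ℝ := fun k z => w₃ z * ‖dt (Uk k) z + lap (Uk k) z‖ ^ 2 with hF₂
  set f₂ : ℝ × E → ℝ := fun z => w₃ z * ‖dt U z + lap U z‖ ^ 2 with hf₂
  have cF₁ : ∀ k, Continuous (F₁ k) := fun k =>
    (continuous_mul_norm_sq_of_tsupport_subset hO hw₁ (hks k).continuous (hkO k)).add
      (cG w₂ hw₂ _ ((hks k).of_le (by exact_mod_cast le_top)) (hkO k))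
  have cF₂ : ∀ k, Continuous (F₂ k) := fun k =>
    continuous_mul_norm_sq_of_tsupport_subset hO hw₃
      ((contDiff_dt (hks k)).continuous.add (contDiff_lap (hks k)).continuous)
      ((hPLs _).trans (hkO k))
  -- ## domination
  have hvol : volume K' < ⊤ := hK'c.measure_lt_top
  set R₁ : ℝ := |M₁| * B₀ ^ 2 + |M₂| * ∑ i, Bi i ^ 2 with hR₁
  set R₂ : ℝ := |M₃| * B₃ ^ 2 with hR₂
  have ib₁ : Integrable (K'.indicator fun _ : ℝ × E => R₁) :=
    (integrableOn_const (hs := hvol.ne)).integrable_indicator hK'm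
  have ib₂ : Integrable (K'.indicator fun _ : ℝ × E => R₂) :=
    (integrableOn_const (hs := hvol.ne)).integrable_indicator hK'm
  have hgradk : ∀ k z, gradSq (Uk k) z ≤ ∑ i, Bi i ^ 2 := fun k z =>
    Finset.sum_le_sum fun i _ => by
      have h := bdx k i z
      have h0 : 0 ≤ ‖dx (b i) (Uk k) z‖ := norm_nonneg _
      nlinarith
  have hb₁ : ∀ k, ∀ᵐ z ∂volume, ‖F₁ k z‖ ≤ K'.indicator (fun _ => R₁) z := fun k =>
    Eventually.of_forall fun z => by
      by_cases hz : z ∈ K'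
      · rw [indicator_of_mem hz, Real.norm_eq_abs, hF₁]
        have h1 : |w₁ z| ≤ |M₁| := (hM₁ z hz).trans (le_abs_self _)
        have h2 : |w₂ z| ≤ |M₂| := (hM₂ z hz).trans (le_abs_self _)
        have hU2 : ‖Uk k z‖ ^ 2 ≤ B₀ ^ 2 := by
          have := bU k z; have h0 := norm_nonneg (Uk k z); nlinarith
        calc |w₁ z * ‖Uk k z‖ ^ 2 + w₂ z * gradSq (Uk k) z|
            ≤ |w₁ z| * ‖Uk k z‖ ^ 2 + |w₂ z| * gradSq (Uk k) z := by
              refine (abs_add_le _ _).trans ?_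
              rw [abs_mul, abs_mul, abs_of_nonneg (sq_nonneg ‖Uk k z‖), abs_of_nonneg (gradSq_nonneg _ _)]
          _ ≤ |M₁| * B₀ ^ 2 + |M₂| * ∑ i, Bi i ^ 2 :=
              add_le_add (mul_le_mul h1 hU2 (sq_nonneg _) (abs_nonneg _))
                (mul_le_mul h2 (hgradk k z) (gradSq_nonneg _ _) (abs_nonneg _))
      · rw [indicator_of_notMem hz, hF₁]
        simp [offUk k z hz, offGk k z hz]
  have hb₂ : ∀ k, ∀ᵐ z ∂volume, ‖F₂ k z‖ ≤ K'.indicator (fun _ => R₂) z := fun k =>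
    Eventually.of_forall fun z => by
      by_cases hz : z ∈ K'
      · rw [indicator_of_mem hz, Real.norm_eq_abs, hF₂]
        have h3 : |w₃ z| ≤ |M₃| := (hM₃ z hz).trans (le_abs_self _)
        have hP2 : ‖dt (Uk k) z + lap (Uk k) z‖ ^ 2 ≤ B₃ ^ 2 := by
          have := bPL k z; have h0 := norm_nonneg (dt (Uk k) z + lap (Uk k) z); nlinarith
        show |w₃ z * ‖dt (Uk k) z + lap (Uk k) z‖ ^ 2| ≤ R₂
        rw [abs_mul, abs_of_nonneg (sq_nonneg ‖dt (Uk k) z + lap (Uk k) z‖)]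
        exact mul_le_mul h3 hP2 (sq_nonneg _) (abs_nonneg _)
      · rw [indicator_of_notMem hz, hF₂]
        show ‖w₃ z * ‖dt (Uk k) z + lap (Uk k) z‖ ^ 2‖ ≤ 0
        rw [offPLk k z hz]
        simp
  -- ## pointwise limits
  have hl₁ : ∀ᵐ z ∂volume, Tendsto (fun k => F₁ k z) atTop (𝓝 (f₁ z)) :=
    Eventually.of_forall fun z => by
      have hg : Tendsto (fun k => gradSq (Uk k) z) atTop (𝓝 (gradSq U z)) := by
        simp only [gradSq]
        exact tendsto_finsetSum _ fun i _ => ((limdx i z).norm).pow 2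
      exact ((((limU z).norm).pow 2).const_mul (w₁ z)).add (hg.const_mul (w₂ z))
  have hl₂ : ∀ᵐ z ∂volume, Tendsto (fun k => F₂ k z) atTop (𝓝 (f₂ z)) :=
    Eventually.of_forall fun z => (((limPL z).norm).pow 2).const_mul (w₃ z)
  have hI := tendsto_integral_of_dominated_convergence _ (fun k => (cF₁ k).aestronglyMeasurable) ib₁ hb₁ hl₁
  have hJ := tendsto_integral_of_dominated_convergence _ (fun k => (cF₂ k).aestronglyMeasurable) ib₂ hb₂ hl₂
  exact le_of_tendsto_of_tendsto' hI (hJ.const_mul C) fun k => Hk k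


end Mollify

section C12Corollaries

variable {E : Type*} [NormedAddCommGroup E] [InnerProductSpace ℝ E] [FiniteDimensional ℝ E]
  [MeasurableSpace E] [BorelSpace E]
variable {F : Type*} [NormedAddCommGroup F] [InnerProductSpace ℝ F] [CompleteSpace F]

/-- **The first Carleman inequality (Seregin 2014, Prop. 1.2, (A.1.1)) in the class
`C¹ ∩ {∂ₓu ∈ C¹}`**: `carleman_inequality_first` extends from `C_c^∞` to compactly supported
`u ∈ C¹` with `∂ₑu ∈ C¹` (`e ∈ E`), support in `]0, 2[ × E` (the regularity of the vorticity of a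
solution that is smooth in space and `C¹` in time). [cite: Seregin2014, App. A.1 Prop. 1.2 (A.1.1)] -/
theorem carleman_inequality_first_of_c12 {a : ℝ} (ha : 0 < a) {U : ℝ × E → F}
    (hU1 : ContDiff ℝ 1 U) (hdx1 : ∀ e : E, ContDiff ℝ 1 (dx e U)) (hUc : HasCompactSupport U)
    (hUs : tsupport U ⊆ Ioo (0 : ℝ) 2 ×ˢ (univ : Set E)) :
    ∫ z, carlemanWeight a z * (a / z.1 * ‖U z‖ ^ 2 + gradSq U z) ≤
      11 * Real.exp (4 / 3) * ∫ z, carlemanWeight a z * ‖dt U z + lap U z‖ ^ 2 := by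
  set O : Set (ℝ × E) := Ioo (0 : ℝ) 2 ×ˢ (univ : Set E) with hO
  have hOo : IsOpen O := (isOpen_Ioo.prod isOpen_univ)
  have cw : ContinuousOn (carlemanWeight a : ℝ × E → ℝ) O := fun z hz =>
    ((continuousOn_carlemanWeight a hz.1.1).continuousAt
      ((isOpen_lt continuous_const continuous_fst).mem_nhds (by
        show z.1 / 2 < z.1; linarith [hz.1.1]))).continuousWithinAt
  have cw₁ : ContinuousOn (fun z : ℝ × E => carlemanWeight a z * (a / z.1)) O :=
    cw.mul (continuousOn_const.div continuous_fst.continuousOn fun z hz => hz.1.1.ne')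
  have e : ∀ V : ℝ × E → F, (fun z => carlemanWeight a z * (a / z.1 * ‖V z‖ ^ 2 + gradSq V z)) =
      fun z => carlemanWeight a z * (a / z.1) * ‖V z‖ ^ 2 + carlemanWeight a z * gradSq V z := by
    intro V; funext z; ring
  have H : ∀ V : ℝ × E → F, ContDiff ℝ (⊤ : ℕ∞) V → HasCompactSupport V → tsupport V ⊆ O →
      ∫ z, (carlemanWeight a z * (a / z.1) * ‖V z‖ ^ 2 + carlemanWeight a z * gradSq V z) ≤
        11 * Real.exp (4 / 3) * ∫ z, carlemanWeight a z * ‖dt V z + lap V z‖ ^ 2 := by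
    intro V hV hVc hVs
    have h := carleman_inequality_first hV hVc hVs ha
    rwa [e V] at h
  have h := weightedIneq_of_c12 hOo cw₁ cw cw H hU1 hdx1 hUc hUs
  rwa [e U]

/-- **The second Carleman inequality (Seregin 2014, Prop. 1.3, (A.1.12)) in the class
`C¹ ∩ {∂ₓu ∈ C¹}`**: `carleman_inequality_second` extends from `C_c^∞` to compactly supported
`u ∈ C¹` with `∂ₑu ∈ C¹` (`e ∈ E`), support in `]0, 1[ × {⟪x, eₙ⟫ > 1}`. [cite: Seregin2014, App. A.1 Prop. 1.3 (A.1.12)] -/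
theorem carleman_inequality_second_of_c12 {α a : ℝ} (hα : 1 / 2 < α) (hα1 : α < 1)
    (ha : 2 ≤ a) {en : E} (hen : ‖en‖ = 1) {U : ℝ × E → F} (hU1 : ContDiff ℝ 1 U)
    (hdx1 : ∀ e : E, ContDiff ℝ 1 (dx e U)) (hUc : HasCompactSupport U) (hUs : tsupport U ⊆ Ioo (0 : ℝ) 1 ×ˢ {x : E | 1 < ⟪x, en⟫}) :
    ∫ z, z.1 ^ 2 * Real.exp (2 * phiKR a (kA α) (rhoA α) en z) *
        (a * ‖U z‖ ^ 2 / z.1 ^ 2 + gradSq U z / z.1) ≤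
      (5 + 3 / (2 * α - 1)) *
        ∫ z, z.1 ^ 2 * Real.exp (2 * phiKR a (kA α) (rhoA α) en z) * ‖dt U z + lap U z‖ ^ 2 := by
  set O : Set (ℝ × E) := Ioo (0 : ℝ) 1 ×ˢ {x : E | 1 < ⟪x, en⟫} with hO
  have hOo : IsOpen O := isOpen_Ioo.prod (isOpen_lt continuous_const (continuous_id.inner continuous_const))
  have hOΩ : O ⊆ halfDom en := fun z hz => ⟨hz.1.1, lt_trans zero_lt_one hz.2⟩
  set w : ℝ × E → ℝ := fun z => z.1 ^ 2 * Real.exp (2 * phiKR a (kA α) (rhoA α) en z) with hw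
  have cφ : ContinuousOn (phiKR a (kA α) (rhoA α) en) O :=
    (contDiffOn_phiKR (contDiffOn_kA α) (contDiffOn_rhoA α) a en).continuousOn.mono hOΩ
  have cw : ContinuousOn w O := (continuous_fst.pow 2).continuousOn.mul (continuousOn_const.mul cφ).rexp
  have ct0 : ∀ z ∈ O, z.1 ≠ 0 := fun z hz => hz.1.1.ne'
  have cw₁ : ContinuousOn (fun z => w z * (a / z.1 ^ 2)) O :=
    cw.mul (continuousOn_const.div (continuous_fst.pow 2).continuousOn fun z hz => pow_ne_zero _ (ct0 z hz))
  have cw₂ : ContinuousOn (fun z => w z * (1 / z.1)) O :=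
    cw.mul (continuousOn_const.div continuous_fst.continuousOn ct0)
  have e : ∀ V : ℝ × E → F, (fun z => z.1 ^ 2 * Real.exp (2 * phiKR a (kA α) (rhoA α) en z) *
      (a * ‖V z‖ ^ 2 / z.1 ^ 2 + gradSq V z / z.1)) =
      fun z => w z * (a / z.1 ^ 2) * ‖V z‖ ^ 2 + w z * (1 / z.1) * gradSq V z := by
    intro V; funext z; simp only [hw]; ring
  have H : ∀ V : ℝ × E → F, ContDiff ℝ (⊤ : ℕ∞) V → HasCompactSupport V → tsupport V ⊆ O →
      ∫ z, (w z * (a / z.1 ^ 2) * ‖V z‖ ^ 2 + w z * (1 / z.1) * gradSq V z) ≤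
        (5 + 3 / (2 * α - 1)) * ∫ z, w z * ‖dt V z + lap V z‖ ^ 2 := by
    intro V hV hVc hVs
    have h := carleman_inequality_second hα hα1 ha hen hV hVc hVs
    rwa [e V] at h
  have h := weightedIneq_of_c12 hOo cw₁ cw₂ cw H hU1 hdx1 hUc hUs
  rwa [e U]


end C12Corollaries

end Carleman

end Literature.Analysis.FluidPDE
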